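import Summits.QuantumFields.BalabanUV.Beta.AxialDressingRootedLegs

/-!
# The ROOTED axial dressing `Πᵀ_ρ` — part 3: faithfulness at the corner root (`coProjAt 0 N = coProj N`)

HONEST FRAMING (cell charter, verbatim): «discharging BetaPertH makes Balaban's UV stability UNCONDITIONAL — a real
constructive-QFT result; it is NOT the continuum limit and NOT the Clay problem.»  DERIVED cell leaf (pub-balaban β sub-cell,
lane an2, work-order (P7′)); no statement of Bałaban's papers is typed here, no `[cite:]` tag, no `Prop` fact.  NOT `BetaPertH`;
NOT continuum; NOT Clay.

## What is here

The window-matrix transpose `coProjAt ρ N` of part 1 is a NEW definition (the finite matrix of an5's rooted comb projector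
`RootedComb.axProjAt ρ N`, transposed); `AxialDressing`'s `coProj N` is the corner-rooted transpose written as a signed path
sum.  This part proves they AGREE at `ρ = 0`:

* §9 `coProj_bondInd_eq_pm` — `coProj N (indicator of (β,p)) α q = pm 0 N β p α q` for `p` within `N` of `q` (summation by
  parts `AxialProjector.sum_coProj_mul` on the block-closed neighbourhood `nbhd N q`, plus `RootedComb.axProjAt_zero` and
  `AxialProjector.axProj_map`); `coProjAt_zero_eq_coProj : coProjAt 0 N g α q = coProj N g α q` (window restriction `gWin` by
  `AxialProjector.coProj_congr_local`, then linearity `AxialDressing.coProj_finset_sum` / `coProj_mul_left`);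
* §10 `legCo₁At_zero`, `legCo₂At_zero`, `dressKAt_zero : dressKAt 0 N = AxialDressing.dressK N`, `coProjAtK_zero`, and
  `dressAt_zero_S` / `dressAt_zero_W`: the rooted functor at the corner offset `r = 0` is `AxialDressing.dress`, value by value
  (the constants differ: `cK, cK'` vs `cN, cN'` — only the kernels are compared).

So the (R32-3) base-rooted wall literal v2.19 is the `r = 0` member of the rooted family, and the centred member `dressCtr` is the
one Bałaban's symmetric averaging prescribes; nothing landed is touched.

Provenance: b2b-balaban β sub-cell, unit beta-an2 gen 11, 2026-08-19 (v1); over parts 1–2 and, BY NAME, `Beta.AxialProjector`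
(`sum_coProj_mul`, `coProj_congr_local`, `axProj_map`, `BlockClosed`), `Beta.AxialDressing` (`coProj_finset_sum`, `coProj_mul_left`,
`coProj_eval`, `dress_S`, `dress_W`), `Beta.AveragingContours` (`blk_block`, `blk_add_off`, `off_mem_box`), an5's `Beta.RootedComb`
(`axProjAt_zero`).
-/

open Finset
open scoped BigOperators
open Literature.MathematicalPhysics.QuantumFieldTheory
open Literature.MathematicalPhysics.QuantumFieldTheory.Balaban1983to89
open Literature.MathematicalPhysics.QuantumFieldTheory.Balaban1983to89.Beta
open B12Sec2to5 (l1 l1_nonneg)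
open AffineAveraging (Form0 Form1 unitVec unitVec_apply box toSite)
open AveragingContours (blk off off_mem_box blk_block blk_add_off)
open RootedComb (axProjAt axProjAt_apply axProjAt_zero)
open AxialProjector (axProj axProj_map zsmul_blk_le lt_zsmul_blk_add BlockClosed coProj coProj_congr_local sum_coProj_mul)
open AxialDressing (coProj_finset_sum coProj_mul_left)
open OneStepResolventKernel (Fib LocStencil JetData)

namespace Summit.QuantumFields.BalabanUV.Beta.AxialDressingRooted

variable {n : ℕ}

/-! ## §9 Faithfulness at the corner root: `coProjAt 0 N = AxialDressing`'s `coProj N` -/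

section Bridge

/-- [folklore] A bond near the block of `q` (itself or its endpoint in `B(q)`) lies in the window `q + cube n N`. -/
theorem sub_mem_cube_of_near {N : ℕ} (hN : 1 ≤ N) {q z : Fin n → ℤ} {κ : Fin n}
    (h : blk N z = blk N q ∨ blk N (z + unitVec κ) = blk N q) : z - q ∈ cube n N := by
  rw [mem_cube]
  intro i
  have a1 := zsmul_blk_le hN q i
  have a2 := lt_zsmul_blk_add hN q i
  rw [Pi.sub_apply, abs_le]
  rcases h with h | h
  · have b1 := zsmul_blk_le hN z i
    have b2 := lt_zsmul_blk_add hN z i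
    rw [h] at b1 b2
    constructor <;> omega
  · have b1 := zsmul_blk_le hN (z + unitVec κ) i
    have b2 := lt_zsmul_blk_add hN (z + unitVec κ) i
    rw [h] at b1 b2
    rw [Pi.add_apply, unitVec_apply] at b1 b2
    by_cases hi : i = κ
    · rw [if_pos hi] at b1 b2
      constructor <;> omega
    · rw [if_neg hi] at b1 b2
      constructor <;> omega

/-- [folklore] If `|z_i − q_i| ≤ 2N` for all `i` then the blocks of `z` and `q` differ by at most `2` in every coordinate. -/
theorem blk_sub_blk_mem_cube_two {N : ℕ} (hN : 1 ≤ N) {q z : Fin n → ℤ} (h : ∀ i, |z i - q i| ≤ 2 * (N : ℤ)) :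
    blk N z - blk N q ∈ cube n 2 := by
  rw [mem_cube]
  intro i
  have hN' : (0 : ℤ) < N := by exact_mod_cast hN
  have hN0 : (N : ℤ) ≠ 0 := ne_of_gt hN'
  obtain ⟨lo, hi⟩ := abs_le.1 (h i)
  have e1 : (blk N z - blk N q) i = z i / N - q i / N := rfl
  rw [e1, abs_le]
  push_cast
  constructor
  · have h1 : q i + (-2) * (N : ℤ) ≤ z i := by linarith
    have h2 := Int.ediv_le_ediv hN' h1
    rw [Int.add_mul_ediv_right _ _ hN0] at h2
    linarith
  · have h1 : z i ≤ q i + 2 * (N : ℤ) := by linarith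
    have h2 := Int.ediv_le_ediv hN' h1
    rw [Int.add_mul_ediv_right _ _ hN0] at h2
    linarith

/-- [folklore] The block-closed neighbourhood of `q`: all sites whose block differs from `blk N q` by at most `2` per coordinate. -/
noncomputable def nbhd (N : ℕ) (q : Fin n → ℤ) : Finset (Fin n → ℤ) :=
  (cube n 2).biUnion fun w => (box n N).image fun b => (N : ℤ) • (blk N q + w) + toSite b

/-- [folklore] Membership in `nbhd`. -/
theorem mem_nbhd {N : ℕ} (hN : 1 ≤ N) {q z : Fin n → ℤ} : z ∈ nbhd N q ↔ blk N z - blk N q ∈ cube n 2 := by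
  unfold nbhd
  simp only [Finset.mem_biUnion, Finset.mem_image]
  constructor
  · rintro ⟨w, hw, b, hb, rfl⟩
    rw [blk_block _ hb, add_sub_cancel_left]
    exact hw
  · intro h
    refine ⟨blk N z - blk N q, h, off N z, off_mem_box hN z, ?_⟩
    have e : blk N q + (blk N z - blk N q) = blk N z := by abel
    rw [e, blk_add_off hN z]

/-- [folklore] `nbhd N q` is a union of blocks. -/
theorem nbhd_blockClosed {N : ℕ} (hN : 1 ≤ N) (q : Fin n → ℤ) : BlockClosed N (nbhd N q) := by
  intro p hp c hc
  rw [mem_nbhd hN] at hp ⊢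
  rwa [blk_block _ hc]

/-- [folklore] Sites within `2N` of `q` in every coordinate lie in `nbhd N q`. -/
theorem mem_nbhd_of_abs_sub_le {N : ℕ} (hN : 1 ≤ N) {q z : Fin n → ℤ} (h : ∀ i, |z i - q i| ≤ 2 * (N : ℤ)) :
    z ∈ nbhd N q :=
  (mem_nbhd hN).2 (blk_sub_blk_mem_cube_two hN h)

/-- [folklore] Pairing a family against the indicator of the bond `(α, q)` evaluates it there (`q ∈ U`). -/
theorem sum_mul_bondInd {U : Finset (Fin n → ℤ)} {q : Fin n → ℤ} (hq : q ∈ U) (F : Fin n → (Fin n → ℤ) → ℝ)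
    (α : Fin n) : ∑ x ∈ U, ∑ κ : Fin n, F κ x * (bondInd α q κ x : ℝ) = F α q := by
  rw [Finset.sum_eq_single_of_mem q hq (fun x _ hx => Finset.sum_eq_zero fun κ _ => by
        rw [bondInd_apply, if_neg (fun h => hx h.2), Int.cast_zero, mul_zero])]
  rw [Fintype.sum_eq_single α (fun κ hκ => by
        rw [bondInd_apply, if_neg (fun h => hκ h.1), Int.cast_zero, mul_zero])]
  rw [bondInd_apply, if_pos ⟨rfl, rfl⟩, Int.cast_one, mul_one]

/-- [folklore] Pairing the indicator of the bond `(β, p)` against a family evaluates it there (`p ∈ U`). -/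
theorem sum_bondInd_mul {U : Finset (Fin n → ℤ)} {p : Fin n → ℤ} (hp : p ∈ U) (F : Fin n → (Fin n → ℤ) → ℝ)
    (β : Fin n) : ∑ x ∈ U, ∑ κ : Fin n, (bondInd β p κ x : ℝ) * F κ x = F β p := by
  rw [Finset.sum_eq_single_of_mem p hp (fun x _ hx => Finset.sum_eq_zero fun κ _ => by
        rw [bondInd_apply, if_neg (fun h => hx h.2), Int.cast_zero, zero_mul])]
  rw [Fintype.sum_eq_single β (fun κ hκ => by
        rw [bondInd_apply, if_neg (fun h => hκ h.1), Int.cast_zero, zero_mul])]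
  rw [bondInd_apply, if_pos ⟨rfl, rfl⟩, Int.cast_one, one_mul]

/-- [folklore] The corner-rooted projector transports the integer indicator into `ℝ`. -/
theorem axProj_bondInd_cast (N : ℕ) (α : Fin n) (q : Fin n → ℤ) (β : Fin n) (p : Fin n → ℤ) :
    axProj N (fun κ z => (bondInd α q κ z : ℝ)) β p = (pm 0 N β p α q : ℝ) := by
  rw [pm_eq, RootedComb.axProjAt_zero]
  exact axProj_map (Int.castAddHom ℝ) (bondInd α q) N β p

/-- [folklore] **THE TRANSPOSE IDENTITY AT THE CORNER ROOT:** `AxialDressing`'s path-sum `coProj N` applied to the indicator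
of the bond `(β, p)` and read at `(α, q)` is the matrix entry `pm 0 N β p α q = (Π δ_{(α,q)})(β, p)` — i.e. `coProj N` IS the
transpose of `Π = axProj N = axProjAt 0 N` (by the summation by parts `AxialProjector.sum_coProj_mul` on a block-closed
neighbourhood of `q` containing `p`, `p + e_β`). -/
theorem coProj_bondInd_eq_pm {N : ℕ} (hN : 1 ≤ N) (β : Fin n) {p : Fin n → ℤ} (α : Fin n) {q : Fin n → ℤ}
    (hp : ∀ i, |p i - q i| ≤ (N : ℤ)) :
    coProj N (fun κ z => (bondInd β p κ z : ℝ)) α q = (pm 0 N β p α q : ℝ) := by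
  have hN1 : (1 : ℤ) ≤ N := by exact_mod_cast hN
  have hU : BlockClosed N (nbhd N q) := nbhd_blockClosed hN q
  have hq : q ∈ nbhd N q := mem_nbhd_of_abs_sub_le hN fun i => by
    rw [sub_self, abs_zero]; positivity
  have hpU : p ∈ nbhd N q := mem_nbhd_of_abs_sub_le hN fun i => (hp i).trans (by linarith)
  have hpU' : p + unitVec β ∈ nbhd N q := mem_nbhd_of_abs_sub_le hN fun i => by
    rw [Pi.add_apply, unitVec_apply]
    have h1 := abs_le.1 (hp i)
    rw [abs_le]
    by_cases hi : i = β
    · rw [if_pos hi]; constructor <;> linarith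
    · rw [if_neg hi]; constructor <;> linarith
  have hg : ∀ (κ : Fin n) (z : Fin n → ℤ), (fun κ z => (bondInd β p κ z : ℝ)) κ z ≠ 0 →
      z ∈ nbhd N q ∧ z + unitVec κ ∈ nbhd N q := by
    intro κ z hz
    dsimp only at hz
    rw [bondInd_apply] at hz
    by_cases hc : κ = β ∧ z = p
    · obtain ⟨rfl, rfl⟩ := hc
      exact ⟨hpU, hpU'⟩
    · rw [if_neg hc, Int.cast_zero] at hz
      exact absurd rfl hz
  have key := sum_coProj_mul hN hU (fun κ z => (bondInd β p κ z : ℝ)) (fun κ z => (bondInd α q κ z : ℝ)) hg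
  rw [sum_mul_bondInd hq, sum_bondInd_mul hpU] at key
  rw [key]
  exact axProj_bondInd_cast N α q β p

/-- [folklore] The window restriction of `g` around `q`, written as a finite combination of bond indicators. -/
noncomputable def gWin (N : ℕ) (g : Form1 n ℝ) (q : Fin n → ℤ) : Form1 n ℝ :=
  fun κ z => ∑ v ∈ cube n N, ∑ β : Fin n, g β (q + v) * (bondInd β (q + v) κ z : ℝ)

/-- [folklore] The window restriction agrees with `g` on every bond near the block of `q`. -/
theorem gWin_eq_of_near {N : ℕ} (hN : 1 ≤ N) (g : Form1 n ℝ) {q z : Fin n → ℤ} {κ : Fin n}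
    (hz : blk N z = blk N q ∨ blk N (z + unitVec κ) = blk N q) : gWin N g q κ z = g κ z := by
  have hv : z - q ∈ cube n N := sub_mem_cube_of_near hN hz
  unfold gWin
  rw [Finset.sum_eq_single_of_mem (z - q) hv (fun v _ hvne => Finset.sum_eq_zero fun β _ => by
        rw [bondInd_apply, if_neg (fun h => hvne (by rw [h.2]; abel)), Int.cast_zero, mul_zero])]
  rw [Fintype.sum_eq_single κ (fun β hβ => by
        rw [bondInd_apply, if_neg (fun h => hβ h.1.symm), Int.cast_zero, mul_zero])]
  have e : q + (z - q) = z := by abel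
  rw [bondInd_apply, if_pos ⟨rfl, e.symm⟩, Int.cast_one, mul_one, e]

/-- [folklore] **FAITHFULNESS AT THE CORNER ROOT:** the window-matrix transpose `coProjAt 0 N` of part 1 IS `AxialDressing`'s
path-sum transpose `coProj N` — so every rooted object of this leaf specialises, at `ρ = 0`, to the landed corner-rooted one
(`AxialDressing.dress`, `BalabanStepJetsSucc.JsBalOf`, …), value by value. -/
theorem coProjAt_zero_eq_coProj {N : ℕ} (hN : 1 ≤ N) (g : Form1 n ℝ) (α : Fin n) (q : Fin n → ℤ) :
    coProjAt 0 N g α q = coProj N g α q := by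
  have hloc : coProj N g α q = coProj N (gWin N g q) α q :=
    coProj_congr_local N fun κ z hz => (gWin_eq_of_near hN g hz).symm
  rw [hloc]
  show coProjAt 0 N g α q =
    coProj N (fun κ z => ∑ v ∈ cube n N, (fun v => fun κ z => ∑ β : Fin n, g β (q + v) * (bondInd β (q + v) κ z : ℝ)) v κ z) α q
  rw [coProj_finset_sum, coProjAt_apply]
  refine Finset.sum_congr rfl fun v hv => ?_
  show ∑ β, (pm 0 N β (q + v) α q : ℝ) * g β (q + v) =
    coProj N (fun κ z => ∑ β ∈ Finset.univ, (fun β => fun κ z => g β (q + v) * (bondInd β (q + v) κ z : ℝ)) β κ z) α q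
  rw [coProj_finset_sum]
  refine Finset.sum_congr rfl fun β _ => ?_
  show (pm 0 N β (q + v) α q : ℝ) * g β (q + v) = coProj N (fun κ z => g β (q + v) * (bondInd β (q + v) κ z : ℝ)) α q
  rw [coProj_mul_left, coProj_bondInd_eq_pm hN β α (fun i => by rw [Pi.add_apply, add_sub_cancel_left]; exact (mem_cube.1 hv) i),
    mul_comm]

end Bridge

/-! ## §10 Consequently the rooted dressings at `ρ = 0` are `AxialDressing`'s -/

section BridgeK

variable {d : ℕ}

/-- [folklore] First leg: `legCo₁At 0 N = AxialDressing.legCo₁ N`. -/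
theorem legCo₁At_zero {N : ℕ} (hN : 1 ≤ N) (K : ExpKernelCalculus.MKer (d + 1) (Fib d)) :
    legCo₁At 0 N K = AxialDressing.legCo₁ N K := by
  funext x y a b
  cases a with
  | inr m => rfl
  | inl α =>
    rw [legCo₁At_inl, AxialDressing.legCo₁_inl]
    exact coProjAt_zero_eq_coProj hN _ α x

/-- [folklore] Second leg: `legCo₂At 0 N = AxialDressing.legCo₂ N`. -/
theorem legCo₂At_zero {N : ℕ} (hN : 1 ≤ N) (K : ExpKernelCalculus.MKer (d + 1) (Fib d)) :
    legCo₂At 0 N K = AxialDressing.legCo₂ N K := by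
  funext x y a b
  cases b with
  | inr m => rfl
  | inl β =>
    rw [legCo₂At_inl, AxialDressing.legCo₂_inl]
    exact coProjAt_zero_eq_coProj hN _ β y

/-- [folklore] Kernel dressing: `dressKAt 0 N = AxialDressing.dressK N`. -/
theorem dressKAt_zero {N : ℕ} (hN : 1 ≤ N) (K : ExpKernelCalculus.MKer (d + 1) (Fib d)) :
    dressKAt 0 N K = AxialDressing.dressK N K := by
  rw [dressKAt_eq, legCo₁At_zero hN, legCo₂At_zero hN]
  rfl

/-- [folklore] Bond slot: `coProjAtK 0 N S = AxialDressing`'s entrywise `coProj` (stated valuewise). -/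
theorem coProjAtK_zero {N : ℕ} (hN : 1 ≤ N)
    (S : Fin (d + 1) → (Fin (d + 1) → ℤ) → ExpKernelCalculus.MKer (d + 1) (Fib d))
    (κ : Fin (d + 1)) (u x y : Fin (d + 1) → ℤ) (a b : Fib d) :
    coProjAtK 0 N S κ u x y a b = coProj N (fun κ' u' => S κ' u' x y a b) κ u :=
  coProjAt_zero_eq_coProj hN _ κ u

/-- [folklore] **`dressAt` AT THE CORNER OFFSET `r = 0` IS `AxialDressing.dress`, STENCIL BY STENCIL.** -/
theorem dressAt_zero_S {N : ℕ} [NeZero N] (h0 : (fun _ => (0 : ℕ)) ∈ box (d + 1) N) (J : JetData d N)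
    (κ : Fin (d + 1)) (u : Fin (d + 1) → ℤ) :
    (dressAt h0 J).S κ u = (AxialDressing.dress J).S κ u := by
  have hN := one_le_of_neZero N
  have e0 : toSite (fun _ : Fin (d + 1) => (0 : ℕ)) = 0 := by
    funext i; rfl
  rw [dressAt_S, AxialDressing.dress_S, e0, dressKAt_zero hN]
  congr 1
  funext x y a b
  rw [coProjAtK_zero hN, AxialDressing.coProj_eval]

/-- [folklore] **`dressAt` AT THE CORNER OFFSET IS `AxialDressing.dress`, TABLE BY TABLE.** -/
theorem dressAt_zero_W {N : ℕ} [NeZero N] (h0 : (fun _ => (0 : ℕ)) ∈ box (d + 1) N) (J : JetData d N)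
    (μ : Fin (d + 1)) (y : Fin (d + 1) → ℤ) (ν : Fin (d + 1)) (y' : Fin (d + 1) → ℤ) :
    (dressAt h0 J).W μ y ν y' = (AxialDressing.dress J).W μ y ν y' := by
  have hN := one_le_of_neZero N
  have e0 : toSite (fun _ : Fin (d + 1) => (0 : ℕ)) = 0 := by
    funext i; rfl
  rw [dressAt_W, AxialDressing.dress_W, e0, dressKAt_zero hN]

end BridgeK

end Summit.QuantumFields.BalabanUV.Beta.AxialDressingRooted
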